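import Summits.CriticalPhenomena.Ising3DConformalLimit.Theses.GammaForcesInteraction
import Literature.Barriers.CriticalPhenomena.LaceExpansionIsingAboveFour
import Literature.Probability.LatticeModels.IsingBubbleDivergence
import Literature.Probability.LatticeModels.SusceptibilityMeanFieldBound

/-!
# Birth skeleton (BC3) for crux `GammaForcesInteraction.GammaStrict` — item stmt-CriticalPhenomena-4747

Crux (route `route-CriticalPhenomena-GammaForcesInteraction`, rank 2, FIXED):
`GammaStrict : ∃ κ > 0, ∀ᶠ β in 𝓝[<] β_c(3), ENNReal.ofReal ((β_c(3) − β)^(−(1+κ))) ≤ χ(β)`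
(`γ > 1` on `ℤ³` in power lower-bound form; `χ = susceptibility 3`, `β_c = criticalBeta 3`).

## Line `birth` — the BUBBLE-POWER line ("converse Aizenman–Graham")

Write `t = β_c − β`, `B(β) = Σ_x ⟨σ₀σ_x⟩²_β ∈ [0,∞]` (the tree's
`Literature.Barriers.CriticalPhenomena.NNIsing.bubbleDiagram 3 β`, verbatim
`∑' x, ENNReal.ofReal (twoPointFree 3 β x) ^ 2`, the object of Duminil-Copin–Panis 2025 Thm 1.8 =
`DuminilCopinPanis2025_bubbleDiagram_eq_top`). The thermal identity `∂_β χ = 2dχ²(1 − g̃)`,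
`g̃ ∈ [0,1]` (TasakiHara2015 (10.63)–(10.64); Lebowitz / GKS II) makes `γ > 1` a statement about the
DECAY of the deficiency `1 − g̃(β)` as `β ↑ β_c`. The Aizenman–Graham / Aizenman 1982 inequality
bounds it from BELOW by the bubble, `1 − g̃ ≥ (1 − B/χ)/(1 + B)` (DuminilCopinICM2022 §7.1:
`(1 − B/χ)·2dχ²/(1+B) ≤ ∂_βχ ≤ 2dχ²`), which is the `γ = 1` direction (bubble condition ⇒ mean
field, `NNIsing.IsingBubbleMeanField`). This line bets on the CONVERSE direction:

* `stub_converseAizenmanGraham` (S1, the new inequality, integrated): the susceptibility beats its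
  mean-field lower bound by a POWER OF THE BUBBLE, `t·χ(β) ≥ c·B(β)^θ` near `β_c` — the integrated
  form of `∂_βχ ≤ C·χ²·B^{−θ}` (i.e. `1 − g̃ ≤ C·B^{−θ}`; integrate `−∂_β(1/χ) ≤ 2dC·B^{−θ}` over
  `[β, β_c]` using `1/χ(β_c^-) = 0` = `tendsto_susceptibility_nhdsLT_criticalBeta` and `B` monotone).
  Calibration: TRUE in every dimension where the answer is known or RG-predicted with ONE exponent
  `θ = 1/3`: `d ≥ 5` (`B` bounded, `tχ → c`), `d = 4` (`B ≍ |log t|`, `tχ ≍ |log t|^{1/3}` —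
  theorem for weakly coupled `φ⁴₄`, TasakiHara2015 Thm 12.1; for `n`-component fields the power is
  `(n+2)/(n+8)`), `d = 3` (`B ≍ t^{−(γ−2β)} = t^{−0.584}`, `tχ ≍ t^{−0.237}`: needs `θ ≤ 0.406`),
  `d = 2` (`B ≍ t^{−3/2}`, `tχ ≍ t^{−3/4}`: `θ ≤ 1/2`).
* `stub_bubblePowerDivergence` (S2): the near-critical bubble diverges like a POWER, `B(β) ≥ t^{−κ}`.
  Known: `B(β_c) = ∞` on `ℤ³` (DCP2025 Thm 1.8, tree fact `DuminilCopinPanis2025_bubbleDiagram_eq_top`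
  / barrier conjunct `LaceExpansionIsingAboveFourNarrow.bubbleDiagram_three_eq_top`) with rate only
  `B_n(β_c) ≥ c√(log n)` (Remark 1.9); `B(β) ↑ B(β_c)` by left-continuity. Expected `κ = γ − 2β ≈ 0.584`.
  Foreseen split (NOT filed — two layers max): critical truncated-bubble power growth
  `bubbleDiagram (criticalTwoPoint 3) L ≥ L^{κ₀}` ("averaged `η < 1/2`") + near-critical transport up
  to the sharp length (`sharpLength 3 β ≥ c·t^{−1/3}` from Simon–Lieb + `χ ≥ (12t)⁻¹`; DCP2025 Thm 1.3
  technology `dcp_twoPoint_axis_lower_nearCritical`).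
* `GammaStrict_of` (PROVED, no sorry): S1 → S2 → GammaStrict with `κ' = κθ/2`:
  `t·χ ≥ c·B^θ ≥ c·t^{−κθ}`, so `χ ≥ c·t^{−1−κθ} ≥ t^{−(1+κθ/2)}` once `t^{κθ/2} ≤ c`.

Shape of the cut. S1 is NECESSARY: `GammaStrict` with exponent `1+κ` gives S1 with `θ = κ/(1+κ)`
through the elementary `B(β) ≤ χ(β)` (`0 ≤ ⟨σ₀σ_x⟩ ≤ 1`), and S1 is expected in EVERY dimension
(`θ = 1/3` fits `d = 2, 3, 4, ≥ 5`) — it is the candidate GENERAL inequality of the line, true at the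
`d = 4` calibration point where the crux itself is false; S2 carries ALL the `d = 3` specificity (false
for `d ≥ 4`). Neither stub alone gives the crux: S1 with a merely logarithmic bubble (`d = 4`) gives
`γ = 1`, S2 with the known AG direction gives nothing upward.

Hardest stub: S1 (no upper bound on `|U₄|`-sums by bubble powers is known in `d = 3`; it is an
intersection LOWER bound for random currents). Disproof used: none registered for this crux
(`ledger crux ls stmt-CriticalPhenomena-4747`: no workfiles, 2026-08-17). Negatives index
(11 entries, CriticalPhenomena): none concerns `susceptibility` / bubble statements.
Barriers: `IsingTrivialityFromDimensionFour` / `LongRangeTrivialityOnZ3` — S2 is FALSE for `d ≥ 5`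
and for the RP long-range models with `α < 3/2` (bounded bubble), so nothing dimension- or
interaction-uniform is claimed; S1 is consistent with all of them (it is the `γ = 1` cases that make
S1 cheap there). `BootstrapLatticeBlindness`: both stubs are lattice statements.

`lean check`: sorries ONLY in `stub_converseAizenmanGraham`, `stub_bubblePowerDivergence` (2 = stub
count); `GammaStrict_of` and `GammaStrict_of_stubs` contain no `sorry`; `GammaStrict_of` concludes
`Summit.CriticalPhenomena.Ising3DConformalLimit.Theses.GammaForcesInteraction.GammaStrict` BY NAME.
-/

noncomputable section

namespace Summit.CriticalPhenomena.Ising3DConformalLimit.Cruxes.GammaStrict.Birth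

open Literature.Probability.LatticeModels Filter Topology
open Literature.Barriers.CriticalPhenomena (NNIsing.bubbleDiagram)
open scoped ENNReal Topology

/-- **S1 — converse Aizenman–Graham inequality, integrated form** (the load-bearing new estimate).
There are `θ > 0` and `c > 0` such that for all `β < β_c(3)` close to `β_c(3)`,
`c · B(β)^θ ≤ (β_c(3) − β) · χ(β)` in `[0,∞]`, where `B(β) = Σ_x ⟨σ₀σ_x⟩²_β`
(`NNIsing.bubbleDiagram 3 β`) and `χ(β) = susceptibility 3 β`: the susceptibility exceeds the
mean-field bound `χ ≥ (2d·t)⁻¹` by a power of the bubble. Junk-free: below `β_c`, `1 ≤ B(β) ≤ χ(β) < ∞`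
(`susceptibility_lt_top_of_lt_criticalBeta`). Intended proof: finite-volume differential inequality
`∂_β S_Λ ≤ 2d·S_Λ²·C·B_Λ^{−θ}` (a quantitative dipole-saturation / sub-Wick bound on
`Σ_y Σ_{b} Cov(σ₀σ_y; σ_aσ_b)`, cf. `deriv_volumeSusceptibility_le`, `bondCov_le`), integrated as in
`inv_supSusc_sub_inv_supSusc_le`, then the box limit. Size: XL / open (expected exponent relation
`γ − 1 ≥ θ(γ − 2β)`; consistent with `d = 2, 3, 4, ≥ 5`, see module docstring).
Sources: AizenmanGraham1983, AizenmanCMP1982, TasakiHara2015 (Thm 10.13–10.14, (10.63)–(10.69)),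
DuminilCopinICM2022 §7.1, AizenmanDuminilCopinAnnals2021 (Thm 1.3: bubble powers DO control `U₄` at `d = 4`). -/
theorem stub_converseAizenmanGraham :
    ∃ θ : ℝ, 0 < θ ∧ ∃ c : ℝ, 0 < c ∧
      ∀ᶠ β in 𝓝[<] (criticalBeta 3),
        ENNReal.ofReal c * (NNIsing.bubbleDiagram 3 β) ^ θ ≤
          ENNReal.ofReal (criticalBeta 3 - β) * susceptibility 3 β := by
  sorry

/-- **S2 — power divergence of the near-critical bubble diagram.** There is `κ > 0` such that for
all `β < β_c(3)` close to `β_c(3)`, `(β_c(3) − β)^{−κ} ≤ B(β) = Σ_x ⟨σ₀σ_x⟩²_β`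
(`NNIsing.bubbleDiagram 3 β`, in `[0,∞]`). Known: `B(β_c(3)) = ∞` (Duminil-Copin–Panis 2025,
Thm 1.8 = tree fact `DuminilCopinPanis2025_bubbleDiagram_eq_top`), with rate `B_n(β_c) ≥ c√(log n)`
only (Remark 1.9), and `B(β) ↑ ∞` as `β ↑ β_c`; a POWER is open (it says "`η < 1/2` on average"
plus near-critical transport up to the sharp length `L(β) ≥ c·(β_c−β)^{−1/3}`). Expected
`κ = γ − 2β ≈ 0.584`. FALSE for `d ≥ 5` and for reflection-positive long-range models with
`α < d/2` (bounded bubble) — dimension-specific by design. Size: L / open.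
Sources: DuminilCopinPanis2025LowerBounds (Thm 1.3, Thm 1.8, Rem. 1.9), AizenmanDuminilCopinAnnals2021
(Lemma 6.3, bubble growth at `d = 4`), Literature.Probability.LatticeModels.DuminilCopinPanis2025_bubbleDiagram_eq_top,
Literature.Probability.LatticeModels.dcp_twoPoint_axis_lower_nearCritical. -/
theorem stub_bubblePowerDivergence :
    ∃ κ : ℝ, 0 < κ ∧
      ∀ᶠ β in 𝓝[<] (criticalBeta 3),
        ENNReal.ofReal ((criticalBeta 3 - β) ^ (-κ)) ≤ NNIsing.bubbleDiagram 3 β := by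
  sorry

/-- **Composition (PROVED): S1 → S2 → `GammaStrict`.** From `c·B^θ ≤ t·χ` and `t^{−κ} ≤ B`:
`c·t^{−κθ} ≤ t·χ`, hence `t^{−(1+κθ/2)} ≤ t⁻¹·c·t^{−κθ} ≤ χ` as soon as `t^{κθ/2} ≤ c`, i.e. for
`t < c^{2/(κθ)}`; so `GammaStrict` holds with exponent `κ' = κθ/2`. -/
theorem GammaStrict_of :
    (∃ θ : ℝ, 0 < θ ∧ ∃ c : ℝ, 0 < c ∧
      ∀ᶠ β in 𝓝[<] (criticalBeta 3),
        ENNReal.ofReal c * (NNIsing.bubbleDiagram 3 β) ^ θ ≤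
          ENNReal.ofReal (criticalBeta 3 - β) * susceptibility 3 β) →
    (∃ κ : ℝ, 0 < κ ∧
      ∀ᶠ β in 𝓝[<] (criticalBeta 3),
        ENNReal.ofReal ((criticalBeta 3 - β) ^ (-κ)) ≤ NNIsing.bubbleDiagram 3 β) →
    Summit.CriticalPhenomena.Ising3DConformalLimit.Theses.GammaForcesInteraction.GammaStrict := by
  rintro ⟨θ, hθ, c, hc, h1⟩ ⟨κ, hκ, h2⟩
  unfold Summit.CriticalPhenomena.Ising3DConformalLimit.Theses.GammaForcesInteraction.GammaStrict
  set βc : ℝ := criticalBeta 3 with hβc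
  -- the exponent gained and the threshold below which the constant `c` is absorbed
  set a : ℝ := κ * θ / 2 with ha
  have ha0 : 0 < a := by positivity
  set ε : ℝ := c ^ (1 / a) with hε
  have hε0 : 0 < ε := Real.rpow_pos_of_pos hc _
  refine ⟨a, ha0, ?_⟩
  have hlt : ∀ᶠ β in 𝓝[<] βc, β < βc := eventually_mem_nhdsWithin
  have hnear : ∀ᶠ β in 𝓝[<] βc, βc - ε < β := by
    have hmem : Set.Ioo (βc - ε) βc ∈ 𝓝[<] βc := Ioo_mem_nhdsLT (by linarith)
    filter_upwards [hmem] with β hβ using hβ.1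
  filter_upwards [h1, h2, hlt, hnear] with β h1β h2β hβlt hβnear
  -- abbreviations: `t = β_c - β ∈ (0, ε)`
  have ht0 : 0 < βc - β := sub_pos.2 hβlt
  have htε : βc - β < ε := by linarith
  have ht0' : (0 : ℝ) ≤ βc - β := ht0.le
  -- Step 1: `c · t^{-κθ} ≤ t · χ` in `[0, ∞]`
  have hB : ENNReal.ofReal ((βc - β) ^ (-(κ * θ))) ≤ (NNIsing.bubbleDiagram 3 β) ^ θ := by
    have h := ENNReal.rpow_le_rpow h2β hθ.le
    rw [ENNReal.ofReal_rpow_of_nonneg (Real.rpow_nonneg ht0' _) hθ.le, ← Real.rpow_mul ht0'] at h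
    simpa [neg_mul] using h
  have hstep1 : ENNReal.ofReal (c * (βc - β) ^ (-(κ * θ))) ≤
      ENNReal.ofReal (βc - β) * susceptibility 3 β := by
    calc ENNReal.ofReal (c * (βc - β) ^ (-(κ * θ)))
        = ENNReal.ofReal c * ENNReal.ofReal ((βc - β) ^ (-(κ * θ))) := ENNReal.ofReal_mul hc.le
      _ ≤ ENNReal.ofReal c * (NNIsing.bubbleDiagram 3 β) ^ θ := mul_le_mul_right hB _
      _ ≤ ENNReal.ofReal (βc - β) * susceptibility 3 β := h1β
  -- Step 2: divide by `t`: `t⁻¹ · c · t^{-κθ} ≤ χ`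
  have hstep2 : ENNReal.ofReal ((βc - β)⁻¹ * (c * (βc - β) ^ (-(κ * θ)))) ≤ susceptibility 3 β := by
    have h := mul_le_mul_right hstep1 (ENNReal.ofReal ((βc - β)⁻¹))
    have hcancel : ENNReal.ofReal ((βc - β)⁻¹) * (ENNReal.ofReal (βc - β) * susceptibility 3 β) =
        susceptibility 3 β := by
      rw [← mul_assoc, ← ENNReal.ofReal_mul (inv_nonneg.2 ht0'), inv_mul_cancel₀ ht0.ne',
        ENNReal.ofReal_one, one_mul]
    rw [hcancel, ← ENNReal.ofReal_mul (inv_nonneg.2 ht0')] at h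
    exact h
  -- Step 3: the real inequality `t^{-(1+a)} ≤ t⁻¹ · (c · t^{-κθ})` for `0 < t < ε`
  have hsmall : (βc - β) ^ a ≤ c := by
    calc (βc - β) ^ a ≤ ε ^ a := Real.rpow_le_rpow ht0' htε.le ha0.le
      _ = c := by
        rw [hε, ← Real.rpow_mul hc.le, one_div, inv_mul_cancel₀ ha0.ne', Real.rpow_one]
  have hreal : (βc - β) ^ (-(1 + a)) ≤ (βc - β)⁻¹ * (c * (βc - β) ^ (-(κ * θ))) := by
    have hsplit : (βc - β) ^ (-(1 + a)) = (βc - β)⁻¹ * ((βc - β) ^ a * (βc - β) ^ (-(κ * θ))) := by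
      rw [← Real.rpow_add ht0, ← Real.rpow_neg_one, ← Real.rpow_add ht0]
      congr 1
      rw [ha]; ring
    rw [hsplit]
    refine mul_le_mul_of_nonneg_left ?_ (inv_nonneg.2 ht0')
    exact mul_le_mul_of_nonneg_right hsmall (Real.rpow_nonneg ht0' _)
  exact (ENNReal.ofReal_le_ofReal hreal).trans hstep2

/-- Consistency check (no `sorry` of its own): the hypotheses of `GammaStrict_of` are literally the
two stub statements, so the registered stubs compose to the crux by name. -/
theorem GammaStrict_of_stubs :
    Summit.CriticalPhenomena.Ising3DConformalLimit.Theses.GammaForcesInteraction.GammaStrict :=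
  GammaStrict_of stub_converseAizenmanGraham stub_bubblePowerDivergence

end Summit.CriticalPhenomena.Ising3DConformalLimit.Cruxes.GammaStrict.Birth

end
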